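import Literature.MathematicalPhysics.QuantumFieldTheory.OSSkeletonExplicitBounds
import Literature.MathematicalPhysics.QuantumFieldTheory.SchwartzTensorGeometricNorms
import HarnessLib

/-!
# The slot functions through profiles with geometric seminorm bounds (OS II, Ch. VI.1, linear order)

Topic `Literature/MathematicalPhysics/QuantumFieldTheory`; support file (all proved; no definitions,
no named facts), the *geometric* companion of `OSSkeletonExplicitBounds` for the temperedness
estimate (4.5) of Osterwalder–Schrader II (Comm. Math. Phys. 42 (1975), Thm. 4.1) **with exponent
linear in the number of points and constants of factorial growth** (Ch. VI.1 (6.12)–(6.13),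
(6.17)–(6.18)). In `OSSkeletonExplicitBounds` the generators of a slot are bounded through
`(2^{M+1})ⁿ ∏ⱼ |φⱼ|_M` (every profile charged with the full order `M`); when the profiles have radius
`ρ` this costs `ρ^{-nM}`, quadratic in the number of points. Here the profiles are assumed to have
**geometric seminorm bounds** `p_{k,i}(φⱼ) ≤ a Rᵏ Bⁱ` (`k, i ≤ M`), as the product profiles of
`RadialProductProfiles` do, and the total order is distributed over the profiles by
`schwartzNorm_tensorFin_le_geometric`:

* `seminorm_rotOne_le_geometric`, `seminorm_reflectOne_le_geometric` — the hypothesis passes to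
  rotated and reflected profiles;
* `schwartzNorm_leftGenV_le_geometric`, `schwartzNorm_rightGenV_le_geometric` —
  `|L_{iμ}(u)|_M, |R_{iμ}(u)|_M ≤ 2^{M+1} (slotPosConst (1+‖u‖))ᴹ · 2ⁿ aⁿ Rᴹ max(1, nB)ᴹ`;
* `norm_slotExtV_le_geometric` — **the slot functions, uniformly on `{Re τ ≥ 0}`**:
  `‖slotExtV u τ‖ ≤ C_{n_L} C_{n_R} (2^{M+1})² slotPosConst^{2M} · 2^{k+2} a^{k+2} R^{2M} max(1,(k+2)B)^{2M} · (1+‖u‖)^{2M}`.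

## References

* K. Osterwalder, R. Schrader, *Axioms for Euclidean Green's functions II*, Comm. Math. Phys. 42
  (1975) 281–305, Ch. VI.1 p. 297, (6.12)–(6.13), (6.17)–(6.18). [OsterwalderSchraderCMP1975]
-/

noncomputable section

open Set MeasureTheory
open scoped SchwartzMap InnerProductSpace RealInnerProductSpace

namespace Literature.MathematicalPhysics.QuantumFieldTheory

open Literature.MathematicalPhysics.QuantumLattice (SchwingerFamily IsPositiveTimeMulti schwartzNorm)
open Literature.MathematicalPhysics.QuantumLattice.SchwingerFamily
open Literature.MathematicalPhysics.QuantumLattice.SchwingerFamily.OSSpace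
open OSFrames

variable {d : ℕ}

/-! ### Geometric bounds pass to rotated and reflected profiles -/

/-- Rotations preserve geometric seminorm bounds. [folklore] -/
theorem seminorm_rotOne_le_geometric (L : EuclideanSpace ℝ (Fin d) ≃ₗᵢ[ℝ] EuclideanSpace ℝ (Fin d))
    (ψ : 𝓢(EuclideanSpace ℝ (Fin d), ℂ)) {M : ℕ} {a R B : ℝ}
    (hψ : ∀ k ≤ M, ∀ i ≤ M, SchwartzMap.seminorm ℝ k i ψ ≤ a * R ^ k * B ^ i) :
    ∀ k ≤ M, ∀ i ≤ M, SchwartzMap.seminorm ℝ k i (rotOne L ψ) ≤ a * R ^ k * B ^ i := fun k hk i hi =>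
  (seminorm_rotOne_le L ψ k i).trans (hψ k hk i hi)

/-- Reflections preserve geometric seminorm bounds. [folklore] -/
theorem seminorm_reflectOne_le_geometric [NeZero d] (ψ : 𝓢(EuclideanSpace ℝ (Fin d), ℂ)) {M : ℕ} {a R B : ℝ}
    (hψ : ∀ k ≤ M, ∀ i ≤ M, SchwartzMap.seminorm ℝ k i ψ ≤ a * R ^ k * B ^ i) :
    ∀ k ≤ M, ∀ i ≤ M, SchwartzMap.seminorm ℝ k i (reflectOne ψ) ≤ a * R ^ k * B ^ i := fun k hk i hi =>
  (seminorm_reflectOne_le ψ k i).trans (hψ k hk i hi)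

/-- `max 1 (n B)` is monotone in `n` (`B ≥ 0`). [folklore] -/
theorem max_one_mul_le_of_le {B : ℝ} (hB : 0 ≤ B) {n n' : ℕ} (h : n ≤ n') : max 1 ((n : ℝ) * B) ≤ max 1 ((n' : ℝ) * B) :=
  max_le_max le_rfl (mul_le_mul_of_nonneg_right (by exact_mod_cast h) hB)

/-! ### Generators of a slot through geometric profile bounds -/

section Generators

variable [NeZero d] {k : ℕ} (φ : Fin (k + 2) → 𝓢(EuclideanSpace ℝ (Fin d), ℂ))
  (ξ : Fin (k + 1) → EuclideanSpace ℝ (Fin d)) (ê : Fin d → EuclideanSpace ℝ (Fin d))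
  (i : Fin (k + 1)) (μ : Fin d) (g : ℝ) {M : ℕ} {a R B : ℝ} (hR : 1 ≤ R) (hB : 0 ≤ B) (ha : 0 ≤ a)
  (hφ : ∀ j, ∀ k' ≤ M, ∀ i' ≤ M, SchwartzMap.seminorm ℝ k' i' (φ j) ≤ a * R ^ k' * B ^ i')

include hR hB ha hφ

/-- **Schwartz norm of the left generator through geometric profile bounds**:
`|L_{iμ}(u)|_M ≤ 2^{M+1} (slotPosConst (1 + ‖u‖))ᴹ · 2^{n_L} a^{n_L} Rᴹ max(1, n_L B)ᴹ`. [cite: OsterwalderSchraderCMP1975, Ch. VI.1 (6.17)–(6.18)] -/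
theorem schwartzNorm_leftGenV_le_geometric (u : Fin (k + 1) × Fin d → ℝ) :
    schwartzNorm M (leftGenV i μ φ ξ ê g u) ≤
      2 ^ (M + 1) * (slotPosConst ξ ê g * (1 + ‖u‖)) ^ M *
        (2 ^ nL i * a ^ nL i * R ^ M * max 1 ((nL i : ℝ) * B) ^ M) := by
  unfold leftGenV
  rw [leftGenFnV_eq]
  refine (schwartzNorm_skeletonFnV_le _ _ M).trans ?_
  have hP := one_add_norm_framePos_comp_le ξ ê i μ g u (fun j : Fin (nL i) => Fin.cast (nL_add_nR i) (Fin.castAdd (nR i) j)) 0 rfl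
  simp only [sub_zero] at hP
  -- geometric bounds of the reflected rotated profiles
  have hψ : ∀ j : Fin (nL i), ∀ k' ≤ M, ∀ i' ≤ M,
      SchwartzMap.seminorm ℝ k' i' (reflectOne (φrot i μ φ ê (Fin.castAdd (nR i) (Fin.rev j)))) ≤ a * R ^ k' * B ^ i' :=
    fun j => seminorm_reflectOne_le_geometric _ (seminorm_rotOne_le_geometric _ _ (hφ _))
  have htens := schwartzNorm_tensorFin_le_geometric (fun j : Fin (nL i) => reflectOne (φrot i μ φ ê (Fin.castAdd (nR i) (Fin.rev j))))
    hR hB (fun _ => a) (fun _ => ha) hψ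
  rw [Finset.prod_const, Finset.card_univ, Fintype.card_fin] at htens
  -- the positions: reflected positions have the same norms
  have hpos : 1 + ‖fun j : Fin (nL i) => QuantumLattice.timeReflection d
      (framePos i μ ξ ê g u (Fin.cast (nL_add_nR i) (Fin.castAdd (nR i) (Fin.rev j))))‖ ≤ slotPosConst ξ ê g * (1 + ‖u‖) := by
    refine le_trans ?_ hP
    refine add_le_add le_rfl ((pi_norm_le_iff_of_nonneg (norm_nonneg _)).2 fun j => ?_)
    rw [LinearIsometryEquiv.norm_map]
    exact norm_le_pi_norm (fun j : Fin (nL i) => framePos i μ ξ ê g u (Fin.cast (nL_add_nR i) (Fin.castAdd (nR i) j))) (Fin.rev j)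
  have hS0 : 0 ≤ slotPosConst ξ ê g * (1 + ‖u‖) :=
    mul_nonneg (zero_le_one.trans (one_le_slotPosConst ξ ê g)) (by positivity)
  have h1 : (1 + ‖fun j : Fin (nL i) => QuantumLattice.timeReflection d
      (framePos i μ ξ ê g u (Fin.cast (nL_add_nR i) (Fin.castAdd (nR i) (Fin.rev j))))‖) ^ M ≤
      (slotPosConst ξ ê g * (1 + ‖u‖)) ^ M := pow_le_pow_left₀ (by positivity) hpos M
  have h0 : 0 ≤ 2 ^ nL i * a ^ nL i * R ^ M * max 1 ((nL i : ℝ) * B) ^ M := by positivity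
  exact mul_le_mul (mul_le_mul_of_nonneg_left h1 (by positivity)) htens (QuantumLattice.schwartzNorm_nonneg _ _) (by positivity)

/-- **Schwartz norm of the right generator through geometric profile bounds**:
`|R_{iμ}(u)|_M ≤ 2^{M+1} (slotPosConst (1 + ‖u‖))ᴹ · 2^{n_R} a^{n_R} Rᴹ max(1, n_R B)ᴹ`. [cite: OsterwalderSchraderCMP1975, Ch. VI.1 (6.17)–(6.18)] -/
theorem schwartzNorm_rightGenV_le_geometric (u : Fin (k + 1) × Fin d → ℝ) :
    schwartzNorm M (rightGenV i μ φ ξ ê g u) ≤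
      2 ^ (M + 1) * (slotPosConst ξ ê g * (1 + ‖u‖)) ^ M *
        (2 ^ nR i * a ^ nR i * R ^ M * max 1 ((nR i : ℝ) * B) ^ M) := by
  unfold rightGenV rightGenFnV
  refine (schwartzNorm_skeletonFnV_le _ _ M).trans ?_
  have hP := one_add_norm_framePos_comp_le ξ ê i μ g u (fun j : Fin (nR i) => Fin.cast (nL_add_nR i) (Fin.natAdd (nL i) j))
    (timeVec 0) timeVec_zero
  have hψ : ∀ j : Fin (nR i), ∀ k' ≤ M, ∀ i' ≤ M,
      SchwartzMap.seminorm ℝ k' i' (φrot i μ φ ê (Fin.natAdd (nL i) j)) ≤ a * R ^ k' * B ^ i' :=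
    fun j => seminorm_rotOne_le_geometric _ _ (hφ _)
  have htens := schwartzNorm_tensorFin_le_geometric (fun j : Fin (nR i) => φrot i μ φ ê (Fin.natAdd (nL i) j))
    hR hB (fun _ => a) (fun _ => ha) hψ
  rw [Finset.prod_const, Finset.card_univ, Fintype.card_fin] at htens
  have hS0 : 0 ≤ slotPosConst ξ ê g * (1 + ‖u‖) :=
    mul_nonneg (zero_le_one.trans (one_le_slotPosConst ξ ê g)) (by positivity)
  have h1 : (1 + ‖fun j : Fin (nR i) => framePos i μ ξ ê g u (Fin.cast (nL_add_nR i) (Fin.natAdd (nL i) j)) - timeVec 0‖) ^ M ≤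
      (slotPosConst ξ ê g * (1 + ‖u‖)) ^ M := pow_le_pow_left₀ (by positivity) hP M
  have h0 : 0 ≤ 2 ^ nR i * a ^ nR i * R ^ M * max 1 ((nR i : ℝ) * B) ^ M := by positivity
  exact mul_le_mul (mul_le_mul_of_nonneg_left h1 (by positivity)) htens (QuantumLattice.schwartzNorm_nonneg _ _) (by positivity)

end Generators

/-! ### The slot functions through geometric profile bounds -/

section SlotExt

variable [NeZero d] (𝔖 : SchwingerFamily (EuclideanSpace ℝ (Fin d))) (hE1 : 𝔖.IsEuclideanCovariant)
  (hE2 : 𝔖.IsOSReflectionPositive) {k : ℕ} (φ : Fin (k + 2) → 𝓢(EuclideanSpace ℝ (Fin d), ℂ))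
  (ξ : Fin (k + 1) → EuclideanSpace ℝ (Fin d)) (ê : Fin d → EuclideanSpace ℝ (Fin d))
  (i : Fin (k + 1)) (μ : Fin d) {g r : ℝ}
  (hφ : ∀ j, tsupport (φ j : EuclideanSpace ℝ (Fin d) → ℂ) ⊆ Metric.closedBall 0 r)
  (hê1 : ‖ê μ‖ = 1) (hêê : ∀ ν, 0 ≤ ⟪ê μ, ê ν⟫) (hξ : ∀ i', g ≤ ⟪ê μ, ξ i'⟫)
  (hg : 2 * r < g) (hr : 0 ≤ r)

/-- **The slot functions through geometric profile bounds, uniformly on `{Re τ ≥ 0}`**: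
`‖slotExtV u τ‖ ≤ C_{n_L} C_{n_R} (2^{M+1})² slotPosConst^{2M} · 2^{k+2} a^{k+2} R^{2M} max(1,(k+2)B)^{2M} · (1+‖u‖)^{2M}`
— the profile radius enters through `a` and `B` with total exponent linear in `k`. [cite: OsterwalderSchraderCMP1975, Ch. VI.1 p. 297, (6.12)–(6.13)] -/
theorem norm_slotExtV_le_geometric {s : ℕ} {Cv : ℕ → ℝ} (hCv : ∀ n, 0 ≤ Cv n)
    (hv : ∀ (n : ℕ) (K : 𝓢((Fin n → EuclideanSpace ℝ (Fin d)), ℂ)) (hK : IsPositiveTimeMulti K),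
      ‖ι 𝔖 hE2 (δ 𝔖 hE2 (mkGen K hK))‖ ≤ Cv n * schwartzNorm ((n + n) * s) K)
    {M : ℕ} (hML : (nL i + nL i) * s ≤ M) (hMR : (nR i + nR i) * s ≤ M)
    {a R B : ℝ} (hR : 1 ≤ R) (hB : 0 ≤ B) (ha : 0 ≤ a)
    (hφg : ∀ j, ∀ k' ≤ M, ∀ i' ≤ M, SchwartzMap.seminorm ℝ k' i' (φ j) ≤ a * R ^ k' * B ^ i')
    (u : Fin (k + 1) × Fin d → ℝ) {τ : ℂ} (hτ : 0 ≤ τ.re) :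
    ‖slotExtV 𝔖 hE1 hE2 φ ξ ê i μ hφ hê1 hêê hξ hg hr u τ‖ ≤
      Cv (nL i) * Cv (nR i) * ((2 ^ (M + 1)) ^ 2 * slotPosConst ξ ê g ^ (M + M)) *
        (2 ^ (k + 2) * a ^ (k + 2) * R ^ (M + M) * max 1 (((k : ℝ) + 2) * B) ^ (M + M)) * (1 + ‖u‖) ^ (M + M) := by
  refine (norm_gapContinuation_le _ _ hτ).trans ?_
  set PLg : ℝ := 2 ^ nL i * a ^ nL i * R ^ M * max 1 ((nL i : ℝ) * B) ^ M with hPLg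
  set PRg : ℝ := 2 ^ nR i * a ^ nR i * R ^ M * max 1 ((nR i : ℝ) * B) ^ M with hPRg
  have hPLg0 : 0 ≤ PLg := by positivity
  have hPRg0 : 0 ≤ PRg := by positivity
  have hS0 : 0 ≤ slotPosConst ξ ê g * (1 + ‖u‖) :=
    mul_nonneg (zero_le_one.trans (one_le_slotPosConst ξ ê g)) (by positivity)
  have hL : ‖δ 𝔖 hE2 (mkGen (leftGenV i μ φ ξ ê g (absParams u))
        (isPositiveTimeMulti_leftGenV hφ hê1 hêê hξ hg hr (absParams_nonneg u)))‖ ≤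
      Cv (nL i) * (2 ^ (M + 1) * (slotPosConst ξ ê g * (1 + ‖u‖)) ^ M * PLg) := by
    rw [← norm_ι]
    refine (hv _ _ _).trans (mul_le_mul_of_nonneg_left ?_ (hCv _))
    refine (QuantumLattice.schwartzNorm_mono hML _).trans ?_
    have h := schwartzNorm_leftGenV_le_geometric φ ξ ê i μ g hR hB ha hφg (absParams u)
    rwa [norm_absParams] at h
  have hRt : ‖δ 𝔖 hE2 (mkGen (rightGenV i μ φ ξ ê g (absParams u))
        (isPositiveTimeMulti_rightGenV hφ hê1 hêê hξ hg hr (absParams_nonneg u)))‖ ≤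
      Cv (nR i) * (2 ^ (M + 1) * (slotPosConst ξ ê g * (1 + ‖u‖)) ^ M * PRg) := by
    rw [← norm_ι]
    refine (hv _ _ _).trans (mul_le_mul_of_nonneg_left ?_ (hCv _))
    refine (QuantumLattice.schwartzNorm_mono hMR _).trans ?_
    have h := schwartzNorm_rightGenV_le_geometric φ ξ ê i μ g hR hB ha hφg (absParams u)
    rwa [norm_absParams] at h
  -- `PLg · PRg ≤ 2^{k+2} a^{k+2} R^{2M} max(1,(k+2)B)^{2M}`
  have hk2 : ((k : ℝ) + 2) = ((k + 2 : ℕ) : ℝ) := by push_cast; ring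
  have hmL : max 1 ((nL i : ℝ) * B) ≤ max 1 (((k : ℝ) + 2) * B) := by
    rw [hk2]; exact max_one_mul_le_of_le hB (by have := nL_add_nR i; omega)
  have hmR : max 1 ((nR i : ℝ) * B) ≤ max 1 (((k : ℝ) + 2) * B) := by
    rw [hk2]; exact max_one_mul_le_of_le hB (by have := nL_add_nR i; omega)
  have hm1 : 1 ≤ max 1 (((k : ℝ) + 2) * B) := le_max_left _ _
  have hPP : PLg * PRg ≤ 2 ^ (k + 2) * a ^ (k + 2) * R ^ (M + M) * max 1 (((k : ℝ) + 2) * B) ^ (M + M) := by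
    have hpL : max 1 ((nL i : ℝ) * B) ^ M ≤ max 1 (((k : ℝ) + 2) * B) ^ M := pow_le_pow_left₀ (by positivity) hmL M
    have hpR : max 1 ((nR i : ℝ) * B) ^ M ≤ max 1 (((k : ℝ) + 2) * B) ^ M := pow_le_pow_left₀ (by positivity) hmR M
    calc PLg * PRg ≤ (2 ^ nL i * a ^ nL i * R ^ M * max 1 (((k : ℝ) + 2) * B) ^ M) *
          (2 ^ nR i * a ^ nR i * R ^ M * max 1 (((k : ℝ) + 2) * B) ^ M) := by
          rw [hPLg, hPRg]
          exact mul_le_mul (mul_le_mul_of_nonneg_left hpL (by positivity)) (mul_le_mul_of_nonneg_left hpR (by positivity))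
            (by positivity) (by positivity)
      _ = 2 ^ (nL i + nR i) * a ^ (nL i + nR i) * R ^ (M + M) * max 1 (((k : ℝ) + 2) * B) ^ (M + M) := by
          rw [pow_add, pow_add, pow_add, pow_add]; ring
      _ = _ := by rw [nL_add_nR]
  calc ‖δ 𝔖 hE2 (mkGen (leftGenV i μ φ ξ ê g (absParams u)) _)‖ *
        ‖δ 𝔖 hE2 (mkGen (rightGenV i μ φ ξ ê g (absParams u)) _)‖
      ≤ (Cv (nL i) * (2 ^ (M + 1) * (slotPosConst ξ ê g * (1 + ‖u‖)) ^ M * PLg)) *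
          (Cv (nR i) * (2 ^ (M + 1) * (slotPosConst ξ ê g * (1 + ‖u‖)) ^ M * PRg)) :=
        mul_le_mul hL hRt (norm_nonneg _) (by have := hCv (nL i); positivity)
    _ = Cv (nL i) * Cv (nR i) * ((2 ^ (M + 1)) ^ 2 * slotPosConst ξ ê g ^ (M + M)) * (PLg * PRg) * (1 + ‖u‖) ^ (M + M) := by
        rw [mul_pow, pow_add, pow_add]; ring
    _ ≤ Cv (nL i) * Cv (nR i) * ((2 ^ (M + 1)) ^ 2 * slotPosConst ξ ê g ^ (M + M)) *
          (2 ^ (k + 2) * a ^ (k + 2) * R ^ (M + M) * max 1 (((k : ℝ) + 2) * B) ^ (M + M)) * (1 + ‖u‖) ^ (M + M) := by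
        have hc0 : 0 ≤ Cv (nL i) * Cv (nR i) * ((2 ^ (M + 1)) ^ 2 * slotPosConst ξ ê g ^ (M + M)) := by
          have := hCv (nL i); have := hCv (nR i)
          have := one_le_slotPosConst ξ ê g
          positivity
        exact mul_le_mul_of_nonneg_right (mul_le_mul_of_nonneg_left hPP hc0) (by positivity)

end SlotExt

end Literature.MathematicalPhysics.QuantumFieldTheory
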